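import Literature.NumberTheory.Automorphic.ModularLambdaLaurent
import HarnessLib

/-!
# Modular functions for finite-index subgroups of `SL(2, ℤ)` are algebraic over `ℂ(λ)`

Sequel on the modular `λ`-function. Calegari–Dimitrov–Tang (F. Calegari, V. Dimitrov, Y. Tang,
*The unbounded denominators conjecture*, J. Amer. Math. Soc. **38** (2025), arXiv:2109.09040),
§1 p. 3: for a modular form `f` of weight `0` on a finite index subgroup, "the function `f` is then
an algebraic function of `λ`, with branching only at the three punctures `λ = 0, 1, ∞` of the
modular curve `Y(2)`"; §3, proof of Proposition 15: "`f` is a regular function on some affine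
modular curve `Y` over `ℚ̄` which admits a finite étale map to `Y(2)`". We prove the analytic
statement over `ℂ`:

* `differentiableOn_comp_smul` — `τ ↦ F(g • τ)` is holomorphic on `ℍ` for `g ∈ SL(2, ℤ)` when
  `F` is;
* `exists_polynomial_of_Gamma_two_invariant_of_forall` — the Laurent-polynomial theorem of
  `ModularLambdaLaurent.lean` with the uniform growth hypothesis at all `g ∈ SL(2, ℤ)`;
* **`exists_polynomial_relation_of_invariant`** — let `Γ ≤ SL(2, ℤ)` have finite index and let
  `F : ℍ → ℂ` be holomorphic, `Γ`-invariant, and of exponential type at every cusp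
  (`‖F(g • z)‖ ≤ M_g e^{πk Im z}` high up, for every `g ∈ SL(2, ℤ)` — meromorphy at the cusps).
  Then `F` is ALGEBRAIC over `ℂ(λ)` of degree `≤ d = [Γ(2) : Γ ∩ Γ(2)]`: there are polynomials
  `A₀, …, A_d ∈ ℂ[X]`, `A_d = (X(1 − X))^{kd} ≠ 0`, with `Σₙ Aₙ(λ(τ)) F(τ)ⁿ = 0` on `ℍ`.

## Proof

The norm construction: with `q ↦ g_q` coset representatives of `Γ ∩ Γ(2)` in `Γ(2)` and
`F_q(τ) = F(g_q⁻¹ τ)` (well defined by `Γ`-invariance), `Γ(2)` permutes the `F_q`, so the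
coefficients `aₙ(τ)` of `P_τ(X) = ∏_q (X − F_q(τ))` are `Γ(2)`-invariant holomorphic functions on
`ℍ`, of exponential type `≤ kd` at the three cusps; by
`exists_polynomial_of_Gamma_two_invariant` (`ModularLambdaLaurent.lean`),
`aₙ · (λ(1−λ))^{kd} = Pₙ(λ)`; and `P_τ(F(τ)) = 0` as `F = F_{q₀}` for the trivial coset.

No definitions, no named facts.

## References

* [CalegariDimitrovTang2025] arXiv:2109.09040, §1 p. 3 and §3, proof of Proposition 15.
* G. Shimura, *Introduction to the Arithmetic Theory of Automorphic Functions* (1971), §2.1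
  (modular functions as algebraic functions of a Hauptmodul).
-/

noncomputable section

open Complex Filter Topology Function Metric Set Polynomial
open UpperHalfPlane hiding I
open scoped Real Topology MatrixGroups Modular

namespace Literature.NumberTheory.Automorphic

namespace ModularLambda

open Literature.NumberTheory.EllipticCurves.JacobiThetaNull
open ModularGroup Matrix.SpecialLinearGroup

/-! ### Holomorphy of `τ ↦ F(g • τ)` -/

/-- The image of `g ∈ SL(2, ℤ)` in `GL(2, ℝ)` has determinant `1 > 0`. [folklore] -/
theorem det_mapGL_pos (g : SL(2, ℤ)) : 0 < (mapGL ℝ g).val.det := by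
  have hval : ∀ i j, (mapGL ℝ g).val i j = ((g i j : ℤ) : ℝ) := fun i j ↦ rfl
  have hdetZ : g 0 0 * g 1 1 - g 0 1 * g 1 0 = 1 := by
    have h := g.prop
    rwa [Matrix.det_fin_two] at h
  rw [Matrix.det_fin_two, hval, hval, hval, hval]
  have : ((g 0 0 : ℤ) : ℝ) * (g 1 1 : ℤ) - (g 0 1 : ℤ) * (g 1 0 : ℤ) = 1 := by exact_mod_cast hdetZ
  rw [this]
  exact one_pos

/-- **`τ ↦ F(g • τ)` is holomorphic on `ℍ`** for `g ∈ SL(2, ℤ)` and `F` holomorphic on `ℍ`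
(with Mathlib's extension `ofComplex` off `ℍ`). [folklore] -/
theorem differentiableOn_comp_smul {F : ℂ → ℂ} (hF : DifferentiableOn ℂ F {z : ℂ | 0 < z.im})
    (g : SL(2, ℤ)) :
    DifferentiableOn ℂ (fun τ : ℂ ↦ F ((g • ofComplex τ : ℍ) : ℂ)) {z : ℂ | 0 < z.im} := by
  intro τ hτ
  have hsm : AnalyticAt ℂ (fun z : ℂ ↦ ((mapGL ℝ g • ofComplex z : ℍ) : ℂ)) τ :=
    UpperHalfPlane.analyticAt_smul (det_mapGL_pos g) ⟨τ, hτ⟩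
  have himg : 0 < ((g • ofComplex τ : ℍ) : ℂ).im := (g • ofComplex τ).2
  have hFd : DifferentiableAt ℂ F ((g • ofComplex τ : ℍ) : ℂ) :=
    hF.differentiableAt ((isOpen_lt continuous_const Complex.continuous_im).mem_nhds himg)
  exact (hFd.comp τ hsm.differentiableAt).differentiableWithinAt

/-! ### Coefficients of `∏ (X − c_q)`: holomorphy and growth by induction -/

/-- Coefficients of `(X − c) · p`. [folklore] -/
private theorem coeff_X_sub_C_mul (c : ℂ) (p : ℂ[X]) (n : ℕ) :
    ((X - C c) * p).coeff n = (if n = 0 then 0 else p.coeff (n - 1)) - c * p.coeff n := by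
  rw [sub_mul, coeff_sub, coeff_C_mul]
  rcases n with _ | n
  · rw [coeff_X_mul_zero, if_pos rfl]
  · rw [coeff_X_mul, if_neg (Nat.succ_ne_zero n), Nat.succ_sub_one]

/-- The coefficients of `∏_{q ∈ s} (X − f_q(τ))` are holomorphic in `τ` when the `f_q` are.
[folklore] -/
theorem differentiableOn_coeff_prod_X_sub_C {ι : Type*} {f : ι → ℂ → ℂ} {U : Set ℂ}
    (hf : ∀ q, DifferentiableOn ℂ (f q) U) (s : Finset ι) (n : ℕ) :
    DifferentiableOn ℂ (fun τ ↦ (∏ q ∈ s, (X - C (f q τ))).coeff n) U := by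
  classical
  induction s using Finset.induction_on generalizing n with
  | empty =>
    simp only [Finset.prod_empty, coeff_one]
    exact differentiableOn_const _
  | insert a s ha ih =>
    simp only [Finset.prod_insert ha, coeff_X_sub_C_mul]
    refine DifferentiableOn.sub ?_ ((hf a).mul (ih n))
    split_ifs
    · exact differentiableOn_const _
    · exact ih (n - 1)

/-- The coefficients of `∏_{q ∈ s} (X − f_q(z))` are of exponential type `k · #s` high in `ℍ`
when each `f_q` is of exponential type `k`. [folklore] -/
theorem norm_coeff_prod_X_sub_C_le {ι : Type*} {f : ι → ℍ → ℂ} (k : ℕ)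
    (hf : ∀ q, ∃ B M : ℝ, ∀ z : ℍ, B ≤ z.im → ‖f q z‖ ≤ M * Real.exp (π * k * z.im))
    (s : Finset ι) :
    ∃ B M : ℝ, 0 ≤ M ∧ ∀ (n : ℕ) (z : ℍ), B ≤ z.im →
      ‖(∏ q ∈ s, (X - C (f q z))).coeff n‖ ≤ M * Real.exp (π * k * s.card * z.im) := by
  classical
  induction s using Finset.induction_on with
  | empty =>
    refine ⟨0, 1, zero_le_one, fun n z _ ↦ ?_⟩
    rw [Finset.prod_empty, coeff_one, Finset.card_empty]
    split_ifs <;> simp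
  | insert a s ha ih =>
    obtain ⟨B, Cs, hCs, hs⟩ := ih
    obtain ⟨Ba, Ca, ha'⟩ := hf a
    refine ⟨max (max B Ba) 0, Cs + |Ca| * Cs, by positivity, fun n z hz ↦ ?_⟩
    have hzB : B ≤ z.im := ((le_max_left _ _).trans (le_max_left _ _)).trans hz
    have hzBa : Ba ≤ z.im := ((le_max_right _ _).trans (le_max_left _ _)).trans hz
    have hz0 : 0 ≤ z.im := (le_max_right _ _).trans hz
    rw [Finset.prod_insert ha, coeff_X_sub_C_mul, Finset.card_insert_of_notMem ha]
    -- the two exponential weights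
    set e₁ := Real.exp (π * k * s.card * z.im) with he₁
    set e₂ := Real.exp (π * k * (s.card + 1 : ℕ) * z.im) with he₂
    have he₁e₂ : e₁ ≤ e₂ := by
      rw [he₁, he₂, Real.exp_le_exp]
      push_cast
      have h0 : 0 ≤ π * k * z.im := by positivity
      have : π * (k : ℝ) * (s.card + 1) * z.im = π * k * s.card * z.im + π * k * z.im := by ring
      rw [this]
      linarith
    have hprod : Real.exp (π * k * z.im) * e₁ = e₂ := by
      rw [he₁, he₂, ← Real.exp_add]
      push_cast
      ring_nf
    have h1 : ‖(if n = 0 then (0 : ℂ) else (∏ q ∈ s, (X - C (f q z))).coeff (n - 1))‖ ≤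
        Cs * e₂ := by
      split_ifs
      · rw [norm_zero]; positivity
      · exact (hs _ z hzB).trans (mul_le_mul_of_nonneg_left he₁e₂ hCs)
    have h2 : ‖f a z * (∏ q ∈ s, (X - C (f q z))).coeff n‖ ≤ |Ca| * Cs * e₂ := by
      rw [norm_mul]
      have hfa : ‖f a z‖ ≤ |Ca| * Real.exp (π * k * z.im) :=
        (ha' z hzBa).trans (mul_le_mul_of_nonneg_right (le_abs_self _) (Real.exp_pos _).le)
      calc ‖f a z‖ * ‖(∏ q ∈ s, (X - C (f q z))).coeff n‖
          ≤ (|Ca| * Real.exp (π * k * z.im)) * (Cs * e₁) :=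
            mul_le_mul hfa (hs n z hzB) (norm_nonneg _) (by positivity)
        _ = |Ca| * Cs * (Real.exp (π * k * z.im) * e₁) := by ring
        _ = |Ca| * Cs * e₂ := by rw [hprod]
    calc ‖(if n = 0 then (0 : ℂ) else (∏ q ∈ s, (X - C (f q z))).coeff (n - 1)) -
          f a z * (∏ q ∈ s, (X - C (f q z))).coeff n‖
        ≤ Cs * e₂ + |Ca| * Cs * e₂ := (norm_sub_le _ _).trans (add_le_add h1 h2)
      _ = (Cs + |Ca| * Cs) * e₂ := by ring

/-! ### The Laurent-polynomial theorem with uniform growth hypotheses -/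

/-- `exists_polynomial_of_Gamma_two_invariant` (the Laurent-polynomial theorem of
`ModularLambdaLaurent.lean`) with the growth hypothesis at the three cusps of `Γ(2)` replaced by the
uniform hypothesis "`‖F(g • z)‖ ≤ M_g e^{πk Im z}` high up, for every `g ∈ SL(2, ℤ)`" (take
`g = 1, S, TS`). [cite: CalegariDimitrovTang2025, §4.2 (after Definition 22)] -/
theorem exists_polynomial_of_Gamma_two_invariant_of_forall {F : ℂ → ℂ} (k : ℕ)
    (hF : DifferentiableOn ℂ F {z : ℂ | 0 < z.im})
    (hinv : ∀ γ ∈ CongruenceSubgroup.Gamma 2, ∀ z : ℍ, F ((γ • z : ℍ) : ℂ) = F z)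
    (hgr : ∀ g : SL(2, ℤ), ∃ B M : ℝ, ∀ z : ℍ, B ≤ z.im →
      ‖F ((g • z : ℍ) : ℂ)‖ ≤ M * Real.exp (π * k * z.im)) :
    ∃ P : ℂ[X], P.natDegree ≤ 3 * k ∧ ∀ τ : ℂ, 0 < τ.im →
      F τ * (modularLambda τ ^ k * (1 - modularLambda τ) ^ k) = P.eval (modularLambda τ) := by
  have cusp : ∀ g₀ : SL(2, ℤ), ∃ B M : ℝ, ∀ τ : ℂ, B ≤ τ.im →
      ‖F (if h : 0 < τ.im then ((g₀ • (⟨τ, h⟩ : ℍ) : ℍ) : ℂ) else τ)‖ ≤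
        M * Real.exp (π * k * τ.im) := by
    intro g₀
    obtain ⟨B, M, h⟩ := hgr g₀
    refine ⟨max B 1, M, fun τ hτ ↦ ?_⟩
    have hτ0 : 0 < τ.im := lt_of_lt_of_le one_pos ((le_max_right _ _).trans hτ)
    simp only [dif_pos hτ0]
    exact h ⟨τ, hτ0⟩ ((le_max_left _ _).trans hτ)
  have hinf : ∃ B M : ℝ, ∀ τ : ℂ, B ≤ τ.im → ‖F τ‖ ≤ M * Real.exp (π * k * τ.im) := by
    obtain ⟨B, M, h⟩ := cusp 1
    refine ⟨B, M, fun τ hτ ↦ ?_⟩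
    have := h τ hτ
    by_cases hτ0 : 0 < τ.im
    · simpa [dif_pos hτ0] using this
    · simpa [dif_neg hτ0] using this
  have h0 : ∃ B M : ℝ, ∀ τ : ℂ, B ≤ τ.im → ‖F (-1 / τ)‖ ≤ M * Real.exp (π * k * τ.im) := by
    obtain ⟨B, M, h⟩ := cusp ModularGroup.S
    refine ⟨max B 1, M, fun τ hτ ↦ ?_⟩
    have hτ0 : 0 < τ.im := lt_of_lt_of_le one_pos ((le_max_right _ _).trans hτ)
    have := h τ ((le_max_left _ _).trans hτ)
    rw [dif_pos hτ0, modular_S_smul, UpperHalfPlane.coe_mk, inv_neg] at this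
    rw [neg_div, one_div]
    simpa using this
  have h1 : ∃ B M : ℝ, ∀ τ : ℂ, B ≤ τ.im →
      ‖F (1 - 1 / τ)‖ ≤ M * Real.exp (π * k * τ.im) := by
    obtain ⟨B, M, h⟩ := cusp (ModularGroup.T * ModularGroup.S)
    refine ⟨max B 1, M, fun τ hτ ↦ ?_⟩
    have hτ0 : 0 < τ.im := lt_of_lt_of_le one_pos ((le_max_right _ _).trans hτ)
    have := h τ ((le_max_left _ _).trans hτ)
    rw [dif_pos hτ0, mul_smul, modular_T_smul, coe_vadd, modular_S_smul, UpperHalfPlane.coe_mk,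
      inv_neg] at this
    push_cast at this
    rw [one_div, sub_eq_add_neg]
    simpa using this
  exact exists_polynomial_of_Gamma_two_invariant k hF hinv hinf h0 h1

/-! ### The theorem -/

/-- **Modular functions of finite-index level are algebraic over `ℂ(λ)`.** Let `Γ ≤ SL(2, ℤ)`
be of finite index and `F` holomorphic on `ℍ`, `Γ`-invariant, with
`‖F(g • z)‖ ≤ M_g e^{πk Im z}` for `Im z` large, for every `g ∈ SL(2, ℤ)` (meromorphy at all
cusps). Then there are `d ≥ 1` (the number of cosets of `Γ ∩ Γ(2)` in `Γ(2)`) and polynomials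
`A₀, …, A_d ∈ ℂ[X]` with `A_d = (X(1 − X))^{kd}` (non-zero) and
`Σ_{n ≤ d} Aₙ(λ(τ)) F(τ)ⁿ = 0` for all `τ ∈ ℍ`: `F` is algebraic over `ℂ(λ)` of degree `≤ d`,
integral over `ℂ[λ, λ⁻¹, (1 − λ)⁻¹]`. [cite: CalegariDimitrovTang2025, §1 p. 3 and §3, proof of
Proposition 15] -/
theorem exists_polynomial_relation_of_invariant {Γ : Subgroup SL(2, ℤ)} [Γ.FiniteIndex]
    {F : ℂ → ℂ} (k : ℕ)
    (hF : DifferentiableOn ℂ F {z : ℂ | 0 < z.im})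
    (hinv : ∀ γ ∈ Γ, ∀ z : ℍ, F ((γ • z : ℍ) : ℂ) = F z)
    (hgr : ∀ g : SL(2, ℤ), ∃ B M : ℝ, ∀ z : ℍ, B ≤ z.im →
      ‖F ((g • z : ℍ) : ℂ)‖ ≤ M * Real.exp (π * k * z.im)) :
    ∃ (d : ℕ) (A : ℕ → ℂ[X]), 0 < d ∧ A d = (X * (1 - X)) ^ (k * d) ∧
      ∀ τ : ℂ, 0 < τ.im →
        ∑ n ∈ Finset.range (d + 1), (A n).eval (modularLambda τ) * F τ ^ n = 0 := by
  classical
  set G2 : Subgroup SL(2, ℤ) := CongruenceSubgroup.Gamma 2 with hG2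
  set Γ' : Subgroup G2 := Γ.subgroupOf G2 with hΓ'
  letI : Fintype (G2 ⧸ Γ') := Fintype.ofFinite _
  -- coset functions
  set Fq : G2 ⧸ Γ' → ℂ → ℂ := fun q τ ↦
    F (((((q.out : G2) : SL(2, ℤ))⁻¹ • ofComplex τ : ℍ)) : ℂ) with hFqdef
  -- well defined: `Fq (mk g) z = F (g⁻¹ z)` on `ℍ`
  have hFq : ∀ (g : G2) (z : ℍ),
      Fq (QuotientGroup.mk g) (z : ℂ) = F ((((g : SL(2, ℤ)))⁻¹ • z : ℍ) : ℂ) := by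
    intro g z
    obtain ⟨h, hh⟩ := QuotientGroup.mk_out_eq_mul (s := Γ') g
    have hmem : ((h : G2) : SL(2, ℤ)) ∈ Γ := Subgroup.mem_subgroupOf.mp h.2
    show F ((((((QuotientGroup.mk g : G2 ⧸ Γ').out : G2) : SL(2, ℤ)))⁻¹ •
      ofComplex (z : ℂ) : ℍ) : ℂ) = _
    rw [ofComplex_apply, hh, Subgroup.coe_mul, mul_inv_rev, mul_smul]
    exact hinv _ (inv_mem hmem) _
  -- `Γ(2)` permutes the coset functions
  have hperm : ∀ (δ : G2) (q : G2 ⧸ Γ') (z : ℍ),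
      Fq q ((((δ : SL(2, ℤ)) • z : ℍ)) : ℂ) = Fq (δ⁻¹ • q) (z : ℂ) := by
    intro δ q z
    obtain ⟨g, rfl⟩ := QuotientGroup.mk_surjective q
    rw [hFq, MulAction.Quotient.smul_mk, smul_eq_mul, hFq, Subgroup.coe_mul, Subgroup.coe_inv,
      mul_inv_rev, inv_inv, mul_smul]
  -- holomorphy and growth of the coset functions
  have hFqd : ∀ q, DifferentiableOn ℂ (Fq q) {z : ℂ | 0 < z.im} := fun q ↦
    differentiableOn_comp_smul hF _
  have hFqgr : ∀ (g₀ : SL(2, ℤ)) (q : G2 ⧸ Γ'), ∃ B M : ℝ, ∀ z : ℍ, B ≤ z.im →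
      ‖Fq q ((g₀ • z : ℍ) : ℂ)‖ ≤ M * Real.exp (π * k * z.im) := by
    intro g₀ q
    obtain ⟨B, M, h⟩ := hgr ((((q.out : G2) : SL(2, ℤ)))⁻¹ * g₀)
    refine ⟨B, M, fun z hz ↦ ?_⟩
    have : Fq q ((g₀ • z : ℍ) : ℂ) = F (((((q.out : G2) : SL(2, ℤ))⁻¹ * g₀) • z : ℍ) : ℂ) := by
      simp only [hFqdef, ofComplex_apply, mul_smul]
    rw [this]
    exact h z hz
  -- the polynomial `P τ = ∏_q (X - Fq q τ)` and its degree `d`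
  set d : ℕ := Fintype.card (G2 ⧸ Γ') with hd
  have hdpos : 0 < d := Fintype.card_pos
  set P : ℂ → ℂ[X] := fun τ ↦ ∏ q, (X - C (Fq q τ)) with hP
  have hPdeg : ∀ τ, (P τ).natDegree = d := fun τ ↦ by
    rw [hP, natDegree_finsetProd_X_sub_C_eq_card, Finset.card_univ]
  have hPtop : ∀ τ, (P τ).coeff d = 1 := fun τ ↦ by
    have h := (monic_prod_X_sub_C (fun q ↦ Fq q τ) Finset.univ).coeff_natDegree
    rwa [hPdeg] at h
  have hPinv : ∀ (δ : G2) (z : ℍ), P (((δ : SL(2, ℤ)) • z : ℍ) : ℂ) = P z := by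
    intro δ z
    show ∏ q, (X - C (Fq q ((((δ : SL(2, ℤ)) • z : ℍ)) : ℂ))) = ∏ q, (X - C (Fq q (z : ℂ)))
    calc ∏ q, (X - C (Fq q ((((δ : SL(2, ℤ)) • z : ℍ)) : ℂ)))
        = ∏ q, (X - C (Fq (δ⁻¹ • q) (z : ℂ))) :=
          Finset.prod_congr rfl fun q _ ↦ by rw [hperm]
      _ = ∏ q, (X - C (Fq q (z : ℂ))) :=
          Fintype.prod_equiv (MulAction.toPerm (δ⁻¹ : G2))
            (fun q ↦ X - C (Fq (δ⁻¹ • q) (z : ℂ))) (fun q ↦ X - C (Fq q (z : ℂ)))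
            fun q ↦ by rw [MulAction.toPerm_apply]
  -- the coefficient functions `a n`: holomorphic, `Γ(2)`-invariant, of exponential type `k d`
  have hainv : ∀ n, ∀ γ ∈ CongruenceSubgroup.Gamma 2, ∀ z : ℍ,
      (P ((γ • z : ℍ) : ℂ)).coeff n = (P z).coeff n := by
    intro n γ hγ z
    have := hPinv ⟨γ, hγ⟩ z
    exact congrArg (fun p : ℂ[X] ↦ p.coeff n) this
  have had : ∀ n, DifferentiableOn ℂ (fun τ ↦ (P τ).coeff n) {z : ℂ | 0 < z.im} := fun n ↦
    differentiableOn_coeff_prod_X_sub_C hFqd Finset.univ n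
  -- growth at the three cusps, via `g₀ = 1, S, TS`
  have hgrow : ∀ g₀ : SL(2, ℤ), ∃ B M : ℝ, ∀ (n : ℕ) (z : ℍ), B ≤ z.im →
      ‖(P ((g₀ • z : ℍ) : ℂ)).coeff n‖ ≤ M * Real.exp (π * (k * d : ℕ) * z.im) := by
    intro g₀
    obtain ⟨B, M, -, h⟩ := norm_coeff_prod_X_sub_C_le k
      (f := fun q (z : ℍ) ↦ Fq q ((g₀ • z : ℍ) : ℂ)) (hFqgr g₀) Finset.univ
    refine ⟨B, M, fun n z hz ↦ ?_⟩
    have := h n z hz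
    rw [Finset.card_univ] at this
    convert this using 3
    push_cast
    ring
  have cusp : ∀ (w : ℍ → ℍ) (g₀ : SL(2, ℤ)), (∀ z : ℍ, w z = g₀ • z) → ∀ n,
      ∃ B M : ℝ, ∀ τ : ℂ, B ≤ τ.im →
        ‖(fun τ : ℂ ↦ (P τ).coeff n) (if h : 0 < τ.im then ((w ⟨τ, h⟩ : ℍ) : ℂ) else τ)‖ ≤
          M * Real.exp (π * (k * d : ℕ) * τ.im) := by
    intro w g₀ hw n
    obtain ⟨B, M, h⟩ := hgrow g₀
    refine ⟨max B 1, M, fun τ hτ ↦ ?_⟩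
    have hτ0 : 0 < τ.im := lt_of_lt_of_le one_pos ((le_max_right _ _).trans hτ)
    simp only [dif_pos hτ0, hw]
    exact h n ⟨τ, hτ0⟩ ((le_max_left _ _).trans hτ)
  -- apply the Laurent-polynomial theorem to each coefficient
  have hLaurent : ∀ n, ∃ Q : ℂ[X], ∀ τ : ℂ, 0 < τ.im →
      (P τ).coeff n * (modularLambda τ ^ (k * d) * (1 - modularLambda τ) ^ (k * d)) =
        Q.eval (modularLambda τ) := by
    intro n
    -- hypotheses at `∞`, `0`, `1`
    have hinf : ∃ B M : ℝ, ∀ τ : ℂ, B ≤ τ.im →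
        ‖(P τ).coeff n‖ ≤ M * Real.exp (π * (k * d : ℕ) * τ.im) := by
      obtain ⟨B, M, h⟩ := cusp id 1 (fun z ↦ (one_smul _ z).symm) n
      refine ⟨B, M, fun τ hτ ↦ ?_⟩
      have := h τ hτ
      by_cases hτ0 : 0 < τ.im
      · simpa [dif_pos hτ0] using this
      · simpa [dif_neg hτ0] using this
    have h0 : ∃ B M : ℝ, ∀ τ : ℂ, B ≤ τ.im →
        ‖(P (-1 / τ)).coeff n‖ ≤ M * Real.exp (π * (k * d : ℕ) * τ.im) := by
      obtain ⟨B, M, h⟩ := cusp (fun z ↦ ModularGroup.S • z) ModularGroup.S (fun _ ↦ rfl) n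
      refine ⟨max B 1, M, fun τ hτ ↦ ?_⟩
      have hτ0 : 0 < τ.im := lt_of_lt_of_le one_pos ((le_max_right _ _).trans hτ)
      have := h τ ((le_max_left _ _).trans hτ)
      rw [dif_pos hτ0, modular_S_smul, UpperHalfPlane.coe_mk, inv_neg] at this
      rw [neg_div, one_div]
      simpa using this
    have h1 : ∃ B M : ℝ, ∀ τ : ℂ, B ≤ τ.im →
        ‖(P (1 - 1 / τ)).coeff n‖ ≤ M * Real.exp (π * (k * d : ℕ) * τ.im) := by
      obtain ⟨B, M, h⟩ := cusp (fun z ↦ (ModularGroup.T * ModularGroup.S) • z)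
        (ModularGroup.T * ModularGroup.S) (fun _ ↦ rfl) n
      refine ⟨max B 1, M, fun τ hτ ↦ ?_⟩
      have hτ0 : 0 < τ.im := lt_of_lt_of_le one_pos ((le_max_right _ _).trans hτ)
      have := h τ ((le_max_left _ _).trans hτ)
      rw [dif_pos hτ0, mul_smul, modular_T_smul, coe_vadd, modular_S_smul, UpperHalfPlane.coe_mk,
        inv_neg] at this
      push_cast at this
      rw [one_div, sub_eq_add_neg]
      simpa using this
    obtain ⟨Q, -, hQ⟩ := exists_polynomial_of_Gamma_two_invariant (k * d) (had n) (hainv n)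
      hinf h0 h1
    exact ⟨Q, hQ⟩
  choose Q hQ using hLaurent
  -- Vieta at `F τ`
  have hroot : ∀ τ : ℂ, 0 < τ.im → (P τ).eval (F τ) = 0 := by
    intro τ hτ
    have e : Fq (QuotientGroup.mk (1 : G2)) τ = F τ := by
      have h := hFq 1 ⟨τ, hτ⟩
      rw [Subgroup.coe_one, inv_one, one_smul] at h
      exact h
    rw [hP, eval_prod]
    refine Finset.prod_eq_zero (Finset.mem_univ (QuotientGroup.mk (1 : G2))) ?_
    rw [eval_sub, eval_X, eval_C, e, sub_self]
  refine ⟨d, fun n ↦ if n = d then (X * (1 - X)) ^ (k * d) else Q n, hdpos, if_pos rfl,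
    fun τ hτ ↦ ?_⟩
  have hsum : ∑ n ∈ Finset.range (d + 1), (P τ).coeff n * F τ ^ n = 0 := by
    rw [← hroot τ hτ, eval_eq_sum_range' (by rw [hPdeg]; exact Nat.lt_succ_self d)]
  have hD : ∀ n ∈ Finset.range (d + 1),
      (if n = d then (X * (1 - X)) ^ (k * d) else Q n).eval (modularLambda τ) * F τ ^ n =
        ((P τ).coeff n * F τ ^ n) *
          (modularLambda τ ^ (k * d) * (1 - modularLambda τ) ^ (k * d)) := by
    intro n _
    split_ifs with hn
    · subst hn
      rw [hPtop, one_mul, eval_pow, eval_mul, eval_sub, eval_one, eval_X, mul_pow, mul_comm]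
    · rw [← hQ n τ hτ]
      ring
  rw [Finset.sum_congr rfl hD, ← Finset.sum_mul, hsum, zero_mul]

end ModularLambda

end Literature.NumberTheory.Automorphic

end
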